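import Summits.HodgeConjecture.CorCM.IrreducibleOddWeightsProductSpanMinimal
import Summits.HodgeConjecture.CorCM.DihedralReflexTripleRank
import HarnessLib

/-!
# THE HELLY NUMBER `3` FOR CM SURFACES AND THE BOUND `|T₀| ≤ dim MT(A_i)` ARE ATTAINED: the dihedral surface triple
# `S₁, S₂, S₁′` is a MINIMAL non-additive family — every PAIR has `Hg = Hg × Hg`, the triple has `Hg ⊊ Hg × Hg × Hg`

COR-CM (cell `pub-hodgecm2`, binder seat `b16` gen 61, count-neutral claim BLOCKS ARE MEMBERS, file H7 — sharpness
certificate; theorems only, no definition, no named fact, no `sorry`).  NEW as stated, hence under `Summits/`.  HONEST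
FRAMING: statements about three explicitly hypothesised quartic CM fields (a non-Galois quartic CM field `K₀`, its
reflex-class partner `K₁` inside the dihedral octic closure, and `K₂ ≃ K₀`) and realisations of their CM types; the
existence of such fields is a HYPOTHESIS of every statement (none is constructed here); `HC_CM` is neither used nor
asserted.

Gen 59 (`IrreducibleOddWeightsAdditivityHellyCMFields`): `Hg(∏ A_i) = ∏ Hg(A_i)` is decided on sub-products of at most
`max_i dim Hg(A_i) + 1` factors (CM surfaces: TRIPLES), and a minimal non-additive family `T₀` has `|T₀| ≤ dim MT(A_i)`
for every member.  Seat p2's `DihedralReflexTripleRank` / `DihedralReflexPairCMHodge` / `QuarticCMSameFieldPairs`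
computed the dihedral surface triple: `K₀` non-Galois quartic CM, `K₁` its reflex-class partner (`Hom(K₁, ℂ) ⊆ K₀^{gal}`,
`Hom(K₁, K₀) = ∅`), `K₂ ≃ K₀`, with a SEPARATING family of types (the three simple CM surfaces pairwise non-isogenous):
`cmFamilyRank = 5` for the triple and for each of its three pairs, every member of rank `3`.  Read together:

* **`DihedralReflexTriple.cmFamilyRank_pair_add_two_eq`** / **`…cmFamilyRank_add_three_ne`** — every PAIR is additive
  (`5 + 2 = 3 + 3 + 1`: `Hg(S_i × S_j) = Hg(S_i) × Hg(S_j)`), the TRIPLE is not (`5 + 3 ≠ 3 + 3 + 3 + 1`: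
  `dim Hg(S₁ × S₂ × S₁′) = 4 < 6`);
* **`DihedralReflexTriple.minimal_nonadditive`** — the triple is a MINIMAL non-additive family with
  `|T₀| = 3 = cmTypeRank Φ_j = dim MT(S_j)` for every member: EQUALITY in gen 59's `card_le_cmTypeRank_of_minimal_nonadditive`,
  and the Helly number of additivity for CM surfaces is EXACTLY `3` (pairs do not decide — for tori there is no
  Goursat–Ribet lemma);
* **`DihedralReflexTriple.hodgeClassesProductSpan_pair`** / **`…exists_not_hodgeClassesProductSpan_triple`** — on
  realisations: the Hodge classes of every `S_i^{a} × S_j^{b}` (`i ≠ j`) are exterior products, while some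
  `S_i^{N₁} × ∏_k S_{π₂ k}` with `π₂` taking BOTH other values carries a rational Hodge class which is not a
  `ℂ`-combination of exterior products — the first exceptional mixed class needs all three surfaces.

## References

* [MoonenZarhin1999LowDim] B. Moonen, Yu. Zarhin, *Hodge classes on abelian varieties of low dimension*, Math. Ann.
  315 (1999), "Hodge groups of simple abelian surfaces of CM-type"; §3 (3.1), Remark (3.9).
* [Shimura1998] G. Shimura, *Abelian Varieties with Complex Multiplication and Modular Functions* (1998), §8.4
  Example (2)(B)(C).
* [Gordon1999HodgeAVSurvey] B. B. Gordon, *A survey of the Hodge conjecture for abelian varieties*, 7.4–7.7.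
* [Mai1989] L. Mai, *Lower bounds for the ranks of CM types*, J. Number Theory 32 (1989), §2 Prop. 1 (proof).
-/

set_option autoImplicit false

noncomputable section

open scoped BigOperators

open CategoryTheory CategoryTheory.Limits NumberField IntermediateField

namespace Summit.HodgeConjecture.CorCM

open Literature.NumberTheory.ComplexMultiplication
open Literature.AlgebraicGeometry.Motives (AbelianVariety CMType)
open Literature.AlgebraicGeometry.Motives.AbelianVariety
open Literature.AlgebraicGeometry.HodgeTheory
open Literature.AlgebraicGeometry.ComplexMultiplication (IsCMTypeRealisation)
open Literature.AlgebraicGeometry.Pohlmann1968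

namespace DihedralReflexTriple

variable {K : Fin 3 → Type} [∀ j, Field (K j)] [∀ j, NumberField (K j)] [∀ j, IsCMField (K j)]

/-! ### §1 The three members and the three pairs -/

/-- A sub-family of a separating family is separating (the `Σ`-patterns of its points are patterns of points of the
whole family). [cite: Kubota1965, §2 (p. 115)] [cite: Gordon1999HodgeAVSurvey, 7.4] -/
theorem isSeparatingFamily_subtype {I : Type} {K' : I → Type} [∀ i, Field (K' i)] {Φ : ∀ i, CMType (K' i)}
    (hsep : CMAlgebra.IsSeparatingFamily Φ) (p : I → Prop) :
    CMAlgebra.IsSeparatingFamily (K := fun i : {i // p i} => K' i.1) fun i => Φ i.1 := by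
  rintro ⟨⟨i, hi⟩, s⟩ ⟨⟨i', hi'⟩, s'⟩ hpat
  have h := hsep ⟨i, s⟩ ⟨i', s'⟩ hpat
  obtain ⟨rfl, hss⟩ := Sigma.mk.inj_iff.1 h
  obtain rfl := eq_of_heq hss
  rfl

/-- **Every member has rank `3`** (`dim MT(S_j) = 3`): every CM type of a non-Galois quartic CM field is nondegenerate.
[cite: Shimura1998, §8.4 Example (2)(B)] [cite: MoonenZarhin1999LowDim, "Hodge groups of simple abelian surfaces of CM-type"] -/
theorem cmTypeRank_eq_three (h4₀ : Module.finrank ℚ (K 0) = 4) (hK₀ : ¬IsGalois ℚ (K 0))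
    (h4₁ : Module.finrank ℚ (K 1) = 4) (hK₁ : ¬IsGalois ℚ (K 1)) (e : K 2 ≃+* K 0) (Φ : ∀ j, CMType (K j))
    (j : Fin 3) : cmTypeRank (Φ j) = 3 := by
  let eₐ : K 2 ≃ₐ[ℚ] K 0 := AlgEquiv.ofRingEquiv (f := e) fun q => by simp
  have h4₂ : Module.finrank ℚ (K 2) = 4 := eₐ.toLinearEquiv.finrank_eq.trans h4₀
  have hK₂ : ¬IsGalois ℚ (K 2) := fun h => hK₀ (IsGalois.of_algEquiv eₐ)
  have key : ∀ j, Module.finrank ℚ (K j) = 4 ∧ ¬IsGalois ℚ (K j) := by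
    intro j
    fin_cases j
    · exact ⟨h4₀, hK₀⟩
    · exact ⟨h4₁, hK₁⟩
    · exact ⟨h4₂, hK₂⟩
  have hnd := QuarticCM.isNondegenerate_of_not_isGalois (key j).1 (key j).2 (Φ j)
  rw [isNondegenerate_iff, (key j).1] at hnd
  exact hnd

/-- **Every PAIR of the triple has rank `5`** (nondegenerate).  For `k : Fin 3`, the sub-family on the two other
indices: `{0,1}` and `{1,2}` are dihedral reflex pairs (`K₂ ≃ K₀` has the same Galois closure and admits no embedding of
`K₁` either), `{0,2}` is a separating same-field pair. [cite: MoonenZarhin1999LowDim, "Hodge groups of simple abelian surfaces of CM-type"]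
[cite: Shimura1998, §8.4 Example (2)(B)(C)] -/
theorem cmFamilyRank_erase_eq_five (h4₀ : Module.finrank ℚ (K 0) = 4) (hK₀ : ¬IsGalois ℚ (K 0))
    (h4₁ : Module.finrank ℚ (K 1) = 4) (hK₁ : ¬IsGalois ℚ (K 1))
    (hMK : ∀ (t : K 1 →+* ℂ) (y : K 1), t y ∈ normalClosure ℚ (K 0) ℂ) (hne : IsEmpty (K 1 →+* K 0))
    (e : K 2 ≃+* K 0) (Φ : ∀ j, CMType (K j)) (hsep : CMAlgebra.IsSeparatingFamily Φ) (k : Fin 3) :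
    CMAlgebra.cmFamilyRank (K := fun j : {j // j ∈ Finset.univ.erase k} => K j.1) (fun j => Φ j.1) = 5 := by
  let eₐ : K 2 ≃ₐ[ℚ] K 0 := AlgEquiv.ofRingEquiv (f := e) fun q => by simp
  have h4₂ : Module.finrank ℚ (K 2) = 4 := eₐ.toLinearEquiv.finrank_eq.trans h4₀
  have hK₂ : ¬IsGalois ℚ (K 2) := fun h => hK₀ (IsGalois.of_algEquiv eₐ)
  -- the Galois closure of `K₂ ≃ K₀` contains that of `K₀`, hence the embeddings of `K₁`
  have hNC : normalClosure ℚ (K 0) ℂ ≤ normalClosure ℚ (K 2) ℂ := by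
    rw [normalClosure_le_iff]
    intro f x hx
    obtain ⟨y, rfl⟩ := hx
    exact (f.comp (eₐ : K 2 →ₐ[ℚ] K 0)).fieldRange_le_normalClosure ⟨eₐ.symm y, by simp⟩
  have hMK₂ : ∀ (t : K 1 →+* ℂ) (y : K 1), t y ∈ normalClosure ℚ (K 2) ℂ := fun t y => hNC (hMK t y)
  have hne₂ : IsEmpty (K 1 →+* K 2) := ⟨fun g => hne.false (e.toRingHom.comp g)⟩
  fin_cases k
  · -- the pair `{1, 2}`: reflex pair with base `K₂`
    let i₀ : {j // j ∈ Finset.univ.erase (0 : Fin 3)} := ⟨2, by decide⟩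
    let i₁ : {j // j ∈ Finset.univ.erase (0 : Fin 3)} := ⟨1, by decide⟩
    have h01 : i₀ ≠ i₁ := by decide
    have hI : ∀ j : {j // j ∈ Finset.univ.erase (0 : Fin 3)}, j = i₀ ∨ j = i₁ := by
      rintro ⟨j, hj⟩
      have hj' := (Finset.mem_erase.1 hj).1
      fin_cases j
      · exact absurd rfl hj'
      · exact Or.inr rfl
      · exact Or.inl rfl
    exact DihedralReflexPair.cmFamilyRank_eq_five_of_dihedralReflexPair hI h01 h4₂ hK₂ h4₁ hK₁ hMK₂ hne₂ _
  · -- the pair `{0, 2}`: separating same-field pair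
    let i₀ : {j // j ∈ Finset.univ.erase (1 : Fin 3)} := ⟨0, by decide⟩
    let i₁ : {j // j ∈ Finset.univ.erase (1 : Fin 3)} := ⟨2, by decide⟩
    have h01 : i₀ ≠ i₁ := by decide
    have hI : ∀ j : {j // j ∈ Finset.univ.erase (1 : Fin 3)}, j = i₀ ∨ j = i₁ := by
      rintro ⟨j, hj⟩
      have hj' := (Finset.mem_erase.1 hj).1
      fin_cases j
      · exact Or.inl rfl
      · exact absurd rfl hj'
      · exact Or.inr rfl
    have hnd := QuarticCMPairs.isNondegenerateFamily_of_ringEquiv_of_not_isGalois hI h01 h4₀ hK₀ e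
      (fun j => Φ j.1) (isSeparatingFamily_subtype hsep _)
    rw [CMAlgebra.isNondegenerateFamily_iff, Fintype.sum_eq_add i₀ i₁ h01 fun j hj => absurd (hI j) (by tauto)]
      at hnd
    refine hnd.trans ?_
    change (Module.finrank ℚ (K 0) + Module.finrank ℚ (K 2)) / 2 + 1 = 5
    rw [h4₀, h4₂]
  · -- the pair `{0, 1}`: the reflex pair
    let i₀ : {j // j ∈ Finset.univ.erase (2 : Fin 3)} := ⟨0, by decide⟩
    let i₁ : {j // j ∈ Finset.univ.erase (2 : Fin 3)} := ⟨1, by decide⟩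
    have h01 : i₀ ≠ i₁ := by decide
    have hI : ∀ j : {j // j ∈ Finset.univ.erase (2 : Fin 3)}, j = i₀ ∨ j = i₁ := by
      rintro ⟨j, hj⟩
      have hj' := (Finset.mem_erase.1 hj).1
      fin_cases j
      · exact Or.inl rfl
      · exact Or.inr rfl
      · exact absurd rfl hj'
    exact DihedralReflexPair.cmFamilyRank_eq_five_of_dihedralReflexPair hI h01 h4₀ hK₀ h4₁ hK₁ hMK hne _

/-- **Every PAIR is additive: `cmFamilyRank(Φ_i, Φ_j) + 2 = cmTypeRank Φ_i + cmTypeRank Φ_j + 1`** (`5 + 2 = 3 + 3 + 1`;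
`Hg(S_i × S_j) = Hg(S_i) × Hg(S_j)` for all three pairs). [cite: MoonenZarhin1999LowDim, "Hodge groups of simple abelian surfaces of CM-type" and §3 (3.1)] -/
theorem cmFamilyRank_pair_add_two_eq (h4₀ : Module.finrank ℚ (K 0) = 4) (hK₀ : ¬IsGalois ℚ (K 0))
    (h4₁ : Module.finrank ℚ (K 1) = 4) (hK₁ : ¬IsGalois ℚ (K 1))
    (hMK : ∀ (t : K 1 →+* ℂ) (y : K 1), t y ∈ normalClosure ℚ (K 0) ℂ) (hne : IsEmpty (K 1 →+* K 0))
    (e : K 2 ≃+* K 0) (Φ : ∀ j, CMType (K j)) (hsep : CMAlgebra.IsSeparatingFamily Φ) (k : Fin 3) :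
    CMAlgebra.cmFamilyRank (K := fun j : {j // j ∈ Finset.univ.erase k} => K j.1) (fun j => Φ j.1) +
        (Finset.univ.erase k).card =
      (∑ j ∈ Finset.univ.erase k, cmTypeRank (Φ j)) + 1 := by
  have hrk := cmTypeRank_eq_three h4₀ hK₀ h4₁ hK₁ e Φ
  have hcardT : (Finset.univ.erase k).card = 2 := by
    rw [Finset.card_erase_of_mem (Finset.mem_univ k), Finset.card_univ, Fintype.card_fin]
  rw [cmFamilyRank_erase_eq_five h4₀ hK₀ h4₁ hK₁ hMK hne e Φ hsep k, hcardT, Finset.sum_congr rfl fun j _ => hrk j,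
    Finset.sum_const, hcardT]
  decide

/-- **The TRIPLE is not additive: `cmFamilyRank Φ + 3 ≠ Σ_j cmTypeRank Φ_j + 1`** (`5 + 3 ≠ 9 + 1`:
`dim Hg(S₁ × S₂ × S₁′) = 4 < 6 = Σ dim Hg(S_j)`). [cite: MoonenZarhin1999LowDim, "Hodge groups of simple abelian surfaces of CM-type"]
[cite: Gordon1999HodgeAVSurvey, 7.5–7.7] -/
theorem cmFamilyRank_add_three_ne (h4₀ : Module.finrank ℚ (K 0) = 4) (hK₀ : ¬IsGalois ℚ (K 0))
    (h4₁ : Module.finrank ℚ (K 1) = 4) (hK₁ : ¬IsGalois ℚ (K 1))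
    (hMK : ∀ (t : K 1 →+* ℂ) (y : K 1), t y ∈ normalClosure ℚ (K 0) ℂ) (hne : IsEmpty (K 1 →+* K 0))
    (e : K 2 ≃+* K 0) (Φ : ∀ j, CMType (K j)) :
    CMAlgebra.cmFamilyRank Φ + Fintype.card (Fin 3) ≠ (∑ j, cmTypeRank (Φ j)) + 1 := by
  rw [cmFamilyRank_eq_five h4₀ hK₀ h4₁ hK₁ hMK hne e Φ,
    Finset.sum_congr rfl fun j _ => cmTypeRank_eq_three h4₀ hK₀ h4₁ hK₁ e Φ j, Finset.sum_const, Finset.card_univ,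
    Fintype.card_fin]
  decide

/-! ### §2 The triple is a MINIMAL non-additive family: both bounds of gen 59 are attained -/

/-- **THE DIHEDRAL SURFACE TRIPLE IS A MINIMAL NON-ADDITIVE FAMILY WITH `|T₀| = 3 = dim MT(S_j)` FOR EVERY MEMBER.**
`K₀` non-Galois quartic CM, `K₁` its reflex-class partner, `K₂ ≃ K₀`, a separating family of types `Φ` (three pairwise
non-isogenous simple CM abelian surfaces `S₁, S₂, S₁′`).  Then: the whole family is not additive; every non-empty proper
sub-family is additive; and `|Fin 3| = 3 = cmTypeRank Φ_j` for every `j`.  Hence gen 59's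
`card_le_cmTypeRank_of_minimal_nonadditive` (`|T₀| ≤ dim MT(A_i)`) is an EQUALITY here, and the Helly number of
`Hg(∏ A_i) = ∏ Hg(A_i)` for abelian surfaces of CM type is EXACTLY `3`: all three pairs have `Hg(S_i × S_j) =
Hg(S_i) × Hg(S_j)`, yet `Hg(S₁ × S₂ × S₁′) ⊊ Hg(S₁) × Hg(S₂) × Hg(S₁′)`.
[cite: MoonenZarhin1999LowDim, "Hodge groups of simple abelian surfaces of CM-type" and §3 (3.1), Remark (3.9)]
[cite: Mai1989, §2 Prop. 1 (proof)] [cite: Gordon1999HodgeAVSurvey, 7.5–7.7] -/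
theorem minimal_nonadditive (h4₀ : Module.finrank ℚ (K 0) = 4) (hK₀ : ¬IsGalois ℚ (K 0))
    (h4₁ : Module.finrank ℚ (K 1) = 4) (hK₁ : ¬IsGalois ℚ (K 1))
    (hMK : ∀ (t : K 1 →+* ℂ) (y : K 1), t y ∈ normalClosure ℚ (K 0) ℂ) (hne : IsEmpty (K 1 →+* K 0))
    (e : K 2 ≃+* K 0) (Φ : ∀ j, CMType (K j)) (hsep : CMAlgebra.IsSeparatingFamily Φ) :
    CMAlgebra.cmFamilyRank (K := fun j : ((Finset.univ : Finset (Fin 3)) : Set (Fin 3)) => K j) (fun j => Φ j) +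
        (Finset.univ : Finset (Fin 3)).card ≠ (∑ j ∈ (Finset.univ : Finset (Fin 3)), cmTypeRank (Φ j)) + 1 ∧
      (∀ T : Finset (Fin 3), T ⊂ Finset.univ → T.Nonempty →
        CMAlgebra.cmFamilyRank (K := fun j : (T : Set (Fin 3)) => K j) (fun j => Φ j) + T.card =
          (∑ j ∈ T, cmTypeRank (Φ j)) + 1) ∧
      ∀ j : Fin 3, (Finset.univ : Finset (Fin 3)).card = cmTypeRank (Φ j) := by
  classical
  refine ⟨fun h => ?_, fun T hT hTne => ?_, fun j => ?_⟩
  · -- the whole family, reindexed by `univ`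
    apply cmFamilyRank_add_three_ne h4₀ hK₀ h4₁ hK₁ hMK hne e Φ
    have hr : CMAlgebra.cmFamilyRank (K := fun j : ((Finset.univ : Finset (Fin 3)) : Set (Fin 3)) => K j)
        (fun j => Φ j) = CMAlgebra.cmFamilyRank Φ :=
      CMAlgebra.cmFamilyRank_comp_of_surjective Φ
        (π := fun j : ((Finset.univ : Finset (Fin 3)) : Set (Fin 3)) => (j : Fin 3))
        fun j => ⟨⟨j, Finset.mem_coe.2 (Finset.mem_univ j)⟩, rfl⟩
    rw [hr, Finset.card_univ] at h
    exact h
  · -- a proper non-empty sub-family has one or two members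
    have hcard : T.card ≤ 2 := by
      have h1 := Finset.card_lt_card hT
      rw [Finset.card_univ, Fintype.card_fin] at h1
      omega
    by_cases h2 : T.card = 2
    · -- two members: `T = univ ∖ {k}`
      have hsd : (Finset.univ \ T).card = 1 := by
        rw [Finset.card_sdiff_of_subset hT.1, Finset.card_univ, Fintype.card_fin, h2]
      obtain ⟨k, hk⟩ := Finset.card_eq_one.1 hsd
      have hTk : T = Finset.univ.erase k := by
        ext j
        rw [Finset.mem_erase, and_iff_left (Finset.mem_univ j)]
        constructor
        · intro hj hjk
          have : j ∈ Finset.univ \ T := by rw [hk]; exact Finset.mem_singleton.2 hjk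
          exact (Finset.mem_sdiff.1 this).2 hj
        · intro hjk
          by_contra hj
          have : j ∈ Finset.univ \ T := Finset.mem_sdiff.2 ⟨Finset.mem_univ j, hj⟩
          rw [hk] at this
          exact hjk (Finset.mem_singleton.1 this)
      subst hTk
      exact cmFamilyRank_pair_add_two_eq h4₀ hK₀ h4₁ hK₁ hMK hne e Φ hsep k
    · -- one member: `T = {i}`
      have h1 : T.card = 1 := by
        have := Finset.card_pos.2 hTne
        omega
      obtain ⟨i, rfl⟩ := Finset.card_eq_one.1 h1
      have hr : CMAlgebra.cmFamilyRank (K := fun j : (({i} : Finset (Fin 3)) : Set (Fin 3)) => K j) (fun j => Φ j) =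
          cmTypeRank (Φ i) := by
        rw [← cmFamilyRank_subtype_eq_cmTypeRank Φ i]
        exact (CMAlgebra.cmFamilyRank_comp_of_surjective (fun j : (({i} : Finset (Fin 3)) : Set (Fin 3)) => Φ j)
          (π := fun j : {j // j = i} => (⟨j.1, Finset.mem_coe.2 (Finset.mem_singleton.2 j.2)⟩ :
            (({i} : Finset (Fin 3)) : Set (Fin 3))))
          fun j => ⟨⟨j, Finset.mem_singleton.1 (Finset.mem_coe.1 j.2)⟩, rfl⟩).symm
      rw [hr, Finset.card_singleton, Finset.sum_singleton]
  · rw [Finset.card_univ, Fintype.card_fin, cmTypeRank_eq_three h4₀ hK₀ h4₁ hK₁ e Φ j]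

/-! ### §3 On realisations: pairs have only exterior-product classes, the triple carries the first exceptional one -/

variable {A : Fin 3 → AbelianVariety ℂ} {ιA : ∀ j, 𝓞 (K j) →+* End (A j)}
  {θ : ∀ j, K j →+* Module.End ℂ (complexBetti (A j).X 1)}

/-- **PAIRS: the Hodge classes of every `S_i^{N₁} × S_j^{N₂}` (`i ≠ j`) are exterior products** of Hodge classes of the
two powers (pair additivity and gen 60's G2). [cite: MoonenZarhin1999LowDim, "Hodge groups of simple abelian surfaces of CM-type" and §3 (3.1)] -/
theorem hodgeClassesProductSpan_pair (h4₀ : Module.finrank ℚ (K 0) = 4) (hK₀ : ¬IsGalois ℚ (K 0))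
    (h4₁ : Module.finrank ℚ (K 1) = 4) (hK₁ : ¬IsGalois ℚ (K 1))
    (hMK : ∀ (t : K 1 →+* ℂ) (y : K 1), t y ∈ normalClosure ℚ (K 0) ℂ) (hne : IsEmpty (K 1 →+* K 0))
    (e : K 2 ≃+* K 0) (Φ : ∀ j, CMType (K j)) (hsep : CMAlgebra.IsSeparatingFamily Φ)
    (hA : ∀ j, IsCMTypeRealisation (Φ j) (A j) (ιA j) (θ j)) {i j : Fin 3} (hij : i ≠ j) (N₁ N₂ : ℕ) [NeZero N₁]
    [NeZero N₂] : HodgeClassesProductSpan (⨁ fun _ : Fin N₁ => A i) (⨁ fun _ : Fin N₂ => A j) := by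
  -- the third index
  obtain ⟨k, hki, hkj⟩ : ∃ k : Fin 3, k ≠ i ∧ k ≠ j := by
    have h : ∀ i j : Fin 3, ∃ k : Fin 3, k ≠ i ∧ k ≠ j := by decide
    exact h i j
  have hi : i ∈ Finset.univ.erase k := Finset.mem_erase.2 ⟨hki.symm, Finset.mem_univ i⟩
  have hj : j ∈ Finset.univ.erase k := Finset.mem_erase.2 ⟨hkj.symm, Finset.mem_univ j⟩
  haveI : Nonempty {l // l ∈ Finset.univ.erase k} := ⟨⟨i, hi⟩⟩
  have hadd := cmFamilyRank_pair_add_two_eq h4₀ hK₀ h4₁ hK₁ hMK hne e Φ hsep k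
  rw [← Fintype.card_coe, ← Finset.sum_coe_sort] at hadd
  exact hodgeClassesProductSpan_biproduct_of_cmFamilyRank_add_card_eq (Φ := fun l : {l // l ∈ Finset.univ.erase k} => Φ l.1)
    (A := fun l : {l // l ∈ Finset.univ.erase k} => A l.1) hadd (fun l => hA l.1)
    (fun _ : Fin N₁ => (⟨i, hi⟩ : {l // l ∈ Finset.univ.erase k})) (fun _ : Fin N₂ => ⟨j, hj⟩)
    fun _ _ h => hij (congrArg Subtype.val h)

/-- **THE TRIPLE: the first exceptional mixed class needs all three surfaces.**  For some `i`, `N₁, N₂ ≥ 1` and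
`π₂ : Fin N₂ → Fin 3 ∖ {i}` taking BOTH other values, `S_i^{N₁} × ∏_k S_{π₂ k}` carries a rational Hodge class which is
NOT a `ℂ`-combination of exterior products of Hodge classes of the two factors.
[cite: MoonenZarhin1999LowDim, "Hodge groups of simple abelian surfaces of CM-type" and §3 (3.1)] [cite: Gordon1999HodgeAVSurvey, 7.5–7.7] -/
theorem exists_not_hodgeClassesProductSpan_triple (h4₀ : Module.finrank ℚ (K 0) = 4) (hK₀ : ¬IsGalois ℚ (K 0))
    (h4₁ : Module.finrank ℚ (K 1) = 4) (hK₁ : ¬IsGalois ℚ (K 1))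
    (hMK : ∀ (t : K 1 →+* ℂ) (y : K 1), t y ∈ normalClosure ℚ (K 0) ℂ) (hne : IsEmpty (K 1 →+* K 0))
    (e : K 2 ≃+* K 0) (Φ : ∀ j, CMType (K j)) (hsep : CMAlgebra.IsSeparatingFamily Φ)
    (hA : ∀ j, IsCMTypeRealisation (Φ j) (A j) (ιA j) (θ j)) :
    ∃ (i : Fin 3) (N₁ N₂ : ℕ) (_ : NeZero N₁) (_ : NeZero N₂) (π₂ : Fin N₂ → Fin 3),
      (∀ k, π₂ k ≠ i) ∧ (∀ l, l ≠ i → ∃ k, π₂ k = l) ∧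
        ¬ HodgeClassesProductSpan (⨁ fun _ : Fin N₁ => A i) (⨁ fun k => A (π₂ k)) := by
  obtain ⟨T₀, i, hi, -, -, -, N₁, N₂, hN₁, hN₂, π₂, hπ₂, hnot⟩ :=
    exists_minimal_not_hodgeClassesProductSpan_of_cmFamilyRank_add_card_ne hA
      (cmFamilyRank_add_three_ne h4₀ hK₀ h4₁ hK₁ hMK hne e Φ)
  haveI := hN₁
  haveI := hN₂
  refine ⟨i, N₁, N₂, hN₁, hN₂, π₂, fun k => (Finset.mem_erase.1 (hπ₂ k)).1, fun l hli => ?_, hnot⟩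
  -- if `π₂` missed `l`, it would be constant (the third index) and the pair would have the product-span property
  by_contra hmiss
  push Not at hmiss
  obtain ⟨m, hmi, hml⟩ : ∃ m : Fin 3, m ≠ i ∧ m ≠ l := by
    have h : ∀ i l : Fin 3, ∃ m : Fin 3, m ≠ i ∧ m ≠ l := by decide
    exact h i l
  have hconst : ∀ k, π₂ k = m := by
    intro k
    have h1 : π₂ k ≠ i := (Finset.mem_erase.1 (hπ₂ k)).1
    have h2 : π₂ k ≠ l := hmiss k
    apply Fin.ext
    have ha := (π₂ k).isLt
    have hi' := i.isLt
    have hl' := l.isLt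
    have hm' := m.isLt
    rw [ne_eq, Fin.ext_iff] at h1 h2 hli hmi hml
    omega
  have hfun : (fun k => A (π₂ k)) = fun _ : Fin N₂ => A m := funext fun k => by rw [hconst k]
  apply hnot
  rw [hfun]
  exact hodgeClassesProductSpan_pair h4₀ hK₀ h4₁ hK₁ hMK hne e Φ hsep hA hmi.symm N₁ N₂

end DihedralReflexTriple

end Summit.HodgeConjecture.CorCM

end
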